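import Summits.Ventures.PercRepro.OrbitKAllMarked

/-!
# PercRepro — the typed ORBIT-k rows on arbitrary markings are their injective readings (typer-2, gen 7)

The lead's question (14:43:59Z): every census of C-023 ran over INJECTIVE markings, while the typed row `C023` (and
`C023Skip`) quantify over arbitrary `m : Fin k → V`. This file shows the two readings agree:

* `vertexClass` / `imageClasses` — the open clusters meeting a vertex set; **`markClasses_eq_imageClasses`**: the mark
  classes `N(A)` of `m` are the clusters meeting the IMAGE `univ.image m` (repeated marks change nothing);
  `markClasses_le_card_image` (`N ≤ #image`), `intervalCount_congr` / `antipodalCount_congr` (same image ⇒ same counts);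
* `dedup m` — an injective marking with the same image (`Finset.equivFin`), `dedup_injective`, `image_dedup`;
* **`kappaK_mono_of_le`** — for `k′ ≤ k ≤ 7` and every admissible pair `κ(i, j; k) ≤ κ(i, j; k′)` (finite, `decide`);
* **`C023_of_C023Inj`** / **`C023_iff_C023Inj`**: deduplicate the marking (the counts are unchanged, `k′ = #image ≤ k`),
  use the injective row at `k′`, and compare the constants; pairs with `j > k′` have `a_ij = 0`.
-/

namespace PercRepro

open Finset

namespace MultiGraph

variable {V E : Type*} (G : MultiGraph V E) [DecidableEq V] [Fintype V] [Fintype E]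

/-- The open cluster of `v` inside the vertex set `S`. -/
def vertexClass (ω : Config E) (S : Finset V) (v : V) : Finset V := S.filter fun w => G.Conn ω v w

/-- The number of open clusters meeting the vertex set `S`. -/
def imageClasses (ω : Config E) (S : Finset V) : ℕ := (S.image fun v => G.vertexClass ω S v).card

/-- The index class of the mark `i` (as in `markClasses`). -/
def indexClass (ω : Config E) {k : ℕ} (m : Fin k → V) (i : Fin k) : Finset (Fin k) :=
  univ.filter fun j : Fin k => G.Conn ω (m i) (m j)

/-- `markClasses` counts the distinct index classes. -/
theorem markClasses_eq_card_image_indexClass (ω : Config E) {k : ℕ} (m : Fin k → V) :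
    G.markClasses ω m = (univ.image fun i : Fin k => G.indexClass ω m i).card := rfl

/-- Membership in an index class is read on the marks. -/
theorem mem_indexClass_iff (ω : Config E) {k : ℕ} (m : Fin k → V) (i j : Fin k) :
    j ∈ G.indexClass ω m i ↔ G.Conn ω (m i) (m j) := by
  unfold indexClass
  simp only [Finset.mem_filter, Finset.mem_univ, true_and]

/-- The image of an index class under `m` is the vertex class of `m i` inside the image of `m`. -/
theorem image_indexClass (ω : Config E) {k : ℕ} (m : Fin k → V) (i : Fin k) :
    (G.indexClass ω m i).image m = G.vertexClass ω (univ.image m) (m i) := by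
  ext w
  simp only [Finset.mem_image, vertexClass, Finset.mem_filter, Finset.mem_univ, true_and,
    mem_indexClass_iff]
  constructor
  · rintro ⟨j, hj, rfl⟩
    exact ⟨⟨j, rfl⟩, hj⟩
  · rintro ⟨⟨j, rfl⟩, h⟩
    exact ⟨j, h, rfl⟩

/-- An index class is the preimage of its image: `j ∈ T_i ↔ m j ∈ m '' T_i`. -/
theorem mem_indexClass_iff_mem_image (ω : Config E) {k : ℕ} (m : Fin k → V) (i j : Fin k) :
    j ∈ G.indexClass ω m i ↔ m j ∈ (G.indexClass ω m i).image m := by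
  rw [image_indexClass, vertexClass, Finset.mem_filter, mem_indexClass_iff]
  constructor
  · intro h
    exact ⟨Finset.mem_image_of_mem m (Finset.mem_univ j), h⟩
  · intro h
    exact h.2

/-- **The mark classes are the clusters meeting the image of the marking** — repeated marks change nothing. -/
theorem markClasses_eq_imageClasses (ω : Config E) {k : ℕ} (m : Fin k → V) :
    G.markClasses ω m = G.imageClasses ω (univ.image m) := by
  rw [markClasses_eq_card_image_indexClass, imageClasses, Finset.image_image]
  have hinj : Set.InjOn (fun T : Finset (Fin k) => T.image m)
      ((univ : Finset (Fin k)).image fun i => G.indexClass ω m i) := by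
    intro T hT T' hT' h
    simp only [Finset.coe_image, Finset.coe_univ, Set.image_univ, Set.mem_range] at hT hT'
    obtain ⟨i, rfl⟩ := hT
    obtain ⟨i', rfl⟩ := hT'
    have h' : (G.indexClass ω m i).image m = (G.indexClass ω m i').image m := h
    ext j
    rw [mem_indexClass_iff_mem_image, h', ← mem_indexClass_iff_mem_image]
  rw [← Finset.card_image_of_injOn hinj, Finset.image_image]
  congr 1
  exact Finset.image_congr fun i _ => G.image_indexClass ω m i

/-- At most `#image m` mark classes. -/
theorem markClasses_le_card_image (ω : Config E) {k : ℕ} (m : Fin k → V) :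
    G.markClasses ω m ≤ (univ.image m).card := by
  rw [markClasses_eq_imageClasses]
  exact Finset.card_image_le

variable [DecidableEq E]

/-- Markings with the same image have the same interval counts. -/
theorem intervalCount_congr {k k' : ℕ} {m : Fin k → V} {m' : Fin k' → V}
    (h : (univ : Finset (Fin k)).image m = (univ : Finset (Fin k')).image m') (I D : Config E) (l : ℕ) :
    G.intervalCount m I D l = G.intervalCount m' I D l := by
  unfold intervalCount
  congr 1
  refine Finset.filter_congr fun A _ => ?_
  rw [markClasses_eq_imageClasses, markClasses_eq_imageClasses, h]

/-- Markings with the same image have the same antipodal counts. -/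
theorem antipodalCount_congr {k k' : ℕ} {m : Fin k → V} {m' : Fin k' → V}
    (h : (univ : Finset (Fin k)).image m = (univ : Finset (Fin k')).image m') (I D : Config E) (i j : ℕ) :
    G.antipodalCount m I D i j = G.antipodalCount m' I D i j := by
  unfold antipodalCount
  congr 1
  refine Finset.filter_congr fun A _ => ?_
  rw [markClasses_eq_imageClasses, markClasses_eq_imageClasses, markClasses_eq_imageClasses,
    markClasses_eq_imageClasses, h]

/-- Pairs with `j` above the number of distinct marks have no antipodal pairs. -/
theorem antipodalCount_eq_zero_of_lt {k : ℕ} (m : Fin k → V) (I D : Config E) (i j : ℕ)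
    (hj : (univ.image m).card < j) : G.antipodalCount m I D i j = 0 := by
  unfold antipodalCount
  rw [Finset.card_eq_zero, Finset.filter_eq_empty_iff]
  intro A _ hA
  exact absurd hA.2.2 (ne_of_lt (lt_of_le_of_lt (G.markClasses_le_card_image _ m) hj))

end MultiGraph

/-! ### Deduplicating a marking -/

/-- An injective marking with the image of `m`: the elements of `univ.image m` enumerated by `Finset.equivFin`. -/
noncomputable def dedup {V : Type*} [DecidableEq V] {k : ℕ} (m : Fin k → V) :
    Fin ((univ : Finset (Fin k)).image m).card → V :=
  fun i => (((univ : Finset (Fin k)).image m).equivFin.symm i).1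

/-- `dedup m` is injective. -/
theorem dedup_injective {V : Type*} [DecidableEq V] {k : ℕ} (m : Fin k → V) : Function.Injective (dedup m) := by
  intro i i' h
  exact ((univ : Finset (Fin k)).image m).equivFin.symm.injective (Subtype.ext h)

/-- `dedup m` has the image of `m`. -/
theorem image_dedup {V : Type*} [DecidableEq V] {k : ℕ} (m : Fin k → V) :
    (univ : Finset (Fin ((univ : Finset (Fin k)).image m).card)).image (dedup m) =
      (univ : Finset (Fin k)).image m := by
  ext v
  constructor
  · intro hv
    obtain ⟨i, -, rfl⟩ := Finset.mem_image.1 hv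
    exact (((univ : Finset (Fin k)).image m).equivFin.symm i).2
  · intro hv
    exact Finset.mem_image.2 ⟨((univ : Finset (Fin k)).image m).equivFin ⟨v, hv⟩, Finset.mem_univ _, by simp [dedup]⟩

/-! ### The constants are antitone in `k` (finite check) -/

/-- **`κ(i, j; k) ≤ κ(i, j; k′)` for `k′ ≤ k ≤ 7`** on every admissible pair `1 ≤ i`, `i + 2 ≤ j ≤ k′`. -/
theorem kappaK_mono_of_le :
    ∀ k ∈ Finset.range 8, ∀ k' ∈ Finset.range (k + 1), ∀ j ∈ Finset.range (k' + 1), ∀ i ∈ Finset.range (j + 1),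
      1 ≤ i → i + 2 ≤ j → kappaK i j k ≤ kappaK i j k' := by
  decide +kernel

/-! ### The reduction -/

/-- **The injective row gives the row on arbitrary markings**: deduplicate the marking (the counts only see the
image), apply `C023Inj` at `k′ = #image ≤ k`, compare the constants; pairs with `j > k′` have `a_ij = 0`. -/
theorem C023_of_C023Inj (h : C023Inj) : C023 := by
  intro V E _ _ _ _ G k hk m I D hID i j hi hij hj
  have hk' : ((univ : Finset (Fin k)).image m).card ≤ k := by
    calc ((univ : Finset (Fin k)).image m).card ≤ (univ : Finset (Fin k)).card := Finset.card_image_le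
      _ = k := Finset.card_fin k
  by_cases hjk : j ≤ ((univ : Finset (Fin k)).image m).card
  · have hinj := h G _ (hk'.trans hk) (dedup m) (dedup_injective m) I D hID i j hi hij hjk
    unfold MultiGraph.OrbitK at hinj ⊢
    simp only [G.antipodalCount_congr (image_dedup m), G.intervalCount_congr (image_dedup m)] at hinj
    refine le_trans ?_ hinj
    refine mul_le_mul_of_nonneg_right ?_ (Nat.cast_nonneg _)
    exact kappaK_mono_of_le k (Finset.mem_range.2 (by omega)) _ (Finset.mem_range.2 (by omega)) j
      (Finset.mem_range.2 (by omega)) i (Finset.mem_range.2 (by omega)) hi hij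
  · unfold MultiGraph.OrbitK
    rw [G.antipodalCount_eq_zero_of_lt m I D i j (Nat.lt_of_not_le hjk)]
    simp only [Nat.cast_zero, mul_zero]
    exact Finset.sum_nonneg fun l _ => Nat.cast_nonneg _

/-- **The typed row of record and its injective reading are equivalent.** -/
theorem C023_iff_C023Inj : C023 ↔ C023Inj :=
  ⟨C023Inj_of_C023, C023_of_C023Inj⟩

end PercRepro
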